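import Summits.CriticalPhenomena.PercolationContinuityZ3.Theorems.SahiMasterFamilyKahnModuleBridge

/-!
# Kahn's inequality for a CONJUNCTION versus a DISJUNCTION of literals with arbitrary overlap
# (lineage `prim-master-conj`, gen 55; `--supports stmt-CriticalPhenomena-4575`)

A concrete infinite family from the peelable-class theorem (`…KahnModulePeelable`) written out in the tree's vocabulary
(`sahiE3 (prodBernoulli p)`, via `…KahnModuleBridge`).  Index set `ι = (M ⊕ S) ⊕ T` (three arbitrary finite blocks of coordinates:
`M` = literals shared by `B` and `C`, `S` = private to `B`, `T` = private to `C`), any product measure `prodBernoulli p`: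

* `B = {ω | every coordinate of M ⊔ S lies in ω}`  — the conjunction `⋀_{i ∈ M ⊔ S} x_i` (a principal up-set),
* `C = {ω | some coordinate of M ⊔ T lies in ω}`  — the disjunction `⋁_{j ∈ M ⊔ T} x_j` (NOT principal, not nested with `B`
  unless `T = ∅`, sharing the arbitrary block `M` with `B`).

**`sahiE3_nonneg_conj_disj`**: `0 ≤ sahiE3 (prodBernoulli p) A B C` for EVERY increasing event `A` — Kahn's Conjecture 5 [Kahn 2022,
Conj. 5] for these triples.  Derivation: nested base `(⋀_M, ⋁_M)` on `Set M`, module step `and_left` with `V = ⋀_S` on `Set S`,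
module step `or_left` (after `symm`) with `V = ⋁_T` on `Set T`, then transport along
`Set ((M ⊕ S) ⊕ T) ≃o (Set M × Set S) × Set T` (`Set.sumEquiv` twice).  Also `sahiE3_nonneg_disj_disj`: both `B` and `C` disjunctions
(`⋁_{M ⊔ S}`, `⋁_{M ⊔ T}`) — two non-principal events with overlapping supports.  Nothing here asserts the conjecture in general.
[this work]
-/

open Finset
open scoped BigOperators

namespace Summit.CriticalPhenomena.PercolationContinuityZ3.Theorems.SahiKahnModule

open Literature.Combinatorics.Sahi2008 (bernoulliWeight monotone_ind_of_isUpperSet)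
open Literature.Probability.LatticeModels (prodBernoulli sahiE3)
open Literature.Probability.Percolation.DecisionTree (ind ind_of_mem ind_of_not_mem ind_nonneg)

universe u

/-! ## Symmetry: a peelable pair may occupy any two of the three slots of `E₃` -/

section Slots
variable {X : Type u} [Fintype X] [Preorder X]

omit [Preorder X] in
/-- `E₃` is symmetric in its first two arguments. [this work] -/
theorem kahnK_comm₁₂ (w f g h : X → ℝ) : kahnK w f g h = kahnK w g f h := by
  unfold kahnK
  rw [show f * g * h = g * f * h from by rw [mul_comm f g], show f * g = g * f from mul_comm f g]
  ring

/-- **Any two slots.**  If `(g,h)` is peelable then for every monotone `f ≥ 0` all three placements are nonnegative: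
`E₃(f,g,h)`, `E₃(g,f,h)`, `E₃(g,h,f) ≥ 0` (`E₃` is a symmetric function of its three arguments). [this work] -/
theorem Peelable.kahnK_nonneg_slots {w g h : X → ℝ} (hP : Peelable X w g h) {f : X → ℝ} (hf : Monotone f)
    (hf0 : ∀ x, 0 ≤ f x) : 0 ≤ kahnK w f g h ∧ 0 ≤ kahnK w g f h ∧ 0 ≤ kahnK w g h f := by
  have h1 := hP.kahnPair f hf hf0
  refine ⟨h1, ?_, ?_⟩
  · rwa [← kahnK_comm₁₂]
  · rwa [kahnK_comm₂₃, ← kahnK_comm₁₂]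

end Slots

/-! ## Plumbing: an order isomorphism on the left factor of a product -/

/-- `e × id` as an order isomorphism `X' × Y ≃o X × Y`. [this work] -/
def prodCongrLeft {X X' Y : Type*} [Preorder X] [Preorder X'] [Preorder Y] (e : X' ≃o X) : X' × Y ≃o X × Y where
  toEquiv := e.toEquiv.prodCongr (Equiv.refl Y)
  map_rel_iff' := by intro a b; simp [Prod.le_def]

/-! ## The events -/

/-- The conjunction of all literals of `X`: `{ω | ω = univ}` as an event of `Set X`. [this work] -/
def conjAll (X : Type*) : Set (Set X) := {ω | ∀ x, x ∈ ω}

/-- The disjunction of all literals of `X`: `{ω | ω ≠ ∅}` as an event of `Set X`. [this work] -/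
def disjAll (X : Type*) : Set (Set X) := {ω | ∃ x, x ∈ ω}

/-- `conjAll` is increasing. [this work] -/
theorem isUpperSet_conjAll (X : Type*) : IsUpperSet (conjAll X) := fun _ _ hab ha x => hab (ha x)

/-- `disjAll` is increasing. [this work] -/
theorem isUpperSet_disjAll (X : Type*) : IsUpperSet (disjAll X) := fun _ _ hab ⟨x, hx⟩ => ⟨x, hab hx⟩

/-- The base pair `(⋀_M, ⋁_M)` is peelable on `(Set M, bernoulliWeight p)` (nested one way if `M` is nonempty, the other way if
it is empty). [this work] -/
theorem peelable_conj_disj_base {M : Type u} [Fintype M] (p : M → unitInterval) :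
    Peelable (Set M) (bernoulliWeight p) (ind (conjAll M)) (ind (disjAll M)) := by
  have hw := isProbWeight_bernoulliWeight p
  have hH := isHarris_bernoulliWeight p
  rcases isEmpty_or_nonempty M with hM | hM
  · refine Peelable.symm (Peelable.of_le hw hH (isIndicator_ind _) (isIndicator_ind _)
      (monotone_ind_of_isUpperSet (isUpperSet_disjAll M)) (monotone_ind_of_isUpperSet (isUpperSet_conjAll M)) fun ω => ?_)
    have h1 : ω ∉ disjAll M := fun ⟨x, _⟩ => hM.elim x
    rw [ind_of_not_mem h1]; exact ind_nonneg _ _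
  · refine Peelable.of_le hw hH (isIndicator_ind _) (isIndicator_ind _) (monotone_ind_of_isUpperSet (isUpperSet_conjAll M))
      (monotone_ind_of_isUpperSet (isUpperSet_disjAll M)) fun ω => ?_
    by_cases h : ω ∈ conjAll M
    · have h2 : ω ∈ disjAll M := ⟨Classical.arbitrary M, h _⟩
      rw [ind_of_mem h, ind_of_mem h2]
    · rw [ind_of_not_mem h]; exact ind_nonneg _ _

/-- The pair `((⋀_M)·(⋀_S)~, (⋁_M) ∨ (⋁_T))` is peelable on `(Set M × Set S) × Set T`. [this work] -/
theorem peelable_conj_disj {M S T : Type u} [Fintype M] [Fintype S] [Fintype T] (pM : M → unitInterval)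
    (pS : S → unitInterval) (pT : T → unitInterval) :
    Peelable ((Set M × Set S) × Set T) (prodW (prodW (bernoulliWeight pM) (bernoulliWeight pS)) (bernoulliWeight pT))
      (liftX (liftX (ind (conjAll M)) * liftY (ind (conjAll S))))
      (bor (liftX (ind (disjAll M))) (ind (disjAll T))) := by
  have h1 := Peelable.and_left (peelable_conj_disj_base pM) (isProbWeight_bernoulliWeight pS) (isHarris_bernoulliWeight pS)
    (isIndicator_ind (conjAll S)) (monotone_ind_of_isUpperSet (isUpperSet_conjAll S))
  exact (Peelable.or_left h1.symm (isProbWeight_bernoulliWeight pT) (isHarris_bernoulliWeight pT) (isIndicator_ind (disjAll T))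
    (monotone_ind_of_isUpperSet (isUpperSet_disjAll T))).symm

/-- The pair `((⋁_M) ∨ (⋁_S), (⋁_M) ∨ (⋁_T))` is peelable on `(Set M × Set S) × Set T`. [this work] -/
theorem peelable_disj_disj {M S T : Type u} [Fintype M] [Fintype S] [Fintype T] (pM : M → unitInterval)
    (pS : S → unitInterval) (pT : T → unitInterval) :
    Peelable ((Set M × Set S) × Set T) (prodW (prodW (bernoulliWeight pM) (bernoulliWeight pS)) (bernoulliWeight pT))
      (liftX (bor (ind (disjAll M)) (ind (disjAll S))))
      (bor (liftX (ind (disjAll M))) (ind (disjAll T))) := by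
  have h0 : Peelable (Set M) (bernoulliWeight pM) (ind (disjAll M)) (ind (disjAll M)) :=
    Peelable.of_le (isProbWeight_bernoulliWeight pM) (isHarris_bernoulliWeight pM) (isIndicator_ind _) (isIndicator_ind _)
      (monotone_ind_of_isUpperSet (isUpperSet_disjAll M)) (monotone_ind_of_isUpperSet (isUpperSet_disjAll M)) fun _ => le_rfl
  have h1 := Peelable.or_left h0 (isProbWeight_bernoulliWeight pS) (isHarris_bernoulliWeight pS)
    (isIndicator_ind (disjAll S)) (monotone_ind_of_isUpperSet (isUpperSet_disjAll S))
  exact (Peelable.or_left h1.symm (isProbWeight_bernoulliWeight pT) (isHarris_bernoulliWeight pT) (isIndicator_ind (disjAll T))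
    (monotone_ind_of_isUpperSet (isUpperSet_disjAll T))).symm

/-! ## Transport to `Set ((M ⊕ S) ⊕ T)` -/

section Transport3
variable {M S T : Type u} [Fintype M] [Fintype S] [Fintype T]

/-- The order isomorphism `Set ((M ⊕ S) ⊕ T) ≃o (Set M × Set S) × Set T`. [this work] -/
def split3 (M S T : Type u) : Set ((M ⊕ S) ⊕ T) ≃o (Set M × Set S) × Set T :=
  (Set.sumEquiv : Set ((M ⊕ S) ⊕ T) ≃o Set (M ⊕ S) × Set T).trans (prodCongrLeft (Set.sumEquiv : Set (M ⊕ S) ≃o Set M × Set S))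

omit [Fintype M] [Fintype S] [Fintype T] in
/-- Components of `split3`. [this work] -/
theorem split3_apply (ω : Set ((M ⊕ S) ⊕ T)) :
    split3 M S T ω = ((Sum.inl ⁻¹' (Sum.inl ⁻¹' ω), Sum.inr ⁻¹' (Sum.inl ⁻¹' ω)), Sum.inr ⁻¹' ω) := rfl

/-- The Bernoulli weight of `p` on `Set ((M ⊕ S) ⊕ T)` is the triple product weight through `split3`. [this work] -/
theorem bernoulliWeight_eq_prodW3 (p : (M ⊕ S) ⊕ T → unitInterval) :
    bernoulliWeight p = prodW (prodW (bernoulliWeight (p ∘ Sum.inl ∘ Sum.inl)) (bernoulliWeight (p ∘ Sum.inl ∘ Sum.inr)))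
      (bernoulliWeight (p ∘ Sum.inr)) ∘ split3 M S T := by
  funext ω
  rw [bernoulliWeight_sum, Function.comp_apply, split3_apply, bernoulliWeight_sum (p ∘ Sum.inl)]
  rfl

/-- The conjunction over `M ⊔ S` inside `(M ⊕ S) ⊕ T`, as an event. [this work] -/
def conjMS (M S T : Type u) : Set (Set ((M ⊕ S) ⊕ T)) :=
  {ω | (∀ m : M, Sum.inl (Sum.inl m) ∈ ω) ∧ ∀ s : S, Sum.inl (Sum.inr s) ∈ ω}

/-- The disjunction over `M ⊔ T` inside `(M ⊕ S) ⊕ T`, as an event. [this work] -/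
def disjMT (M S T : Type u) : Set (Set ((M ⊕ S) ⊕ T)) :=
  {ω | (∃ m : M, Sum.inl (Sum.inl m) ∈ ω) ∨ ∃ t : T, Sum.inr t ∈ ω}

/-- The disjunction over `M ⊔ S` inside `(M ⊕ S) ⊕ T`, as an event. [this work] -/
def disjMS (M S T : Type u) : Set (Set ((M ⊕ S) ⊕ T)) :=
  {ω | (∃ m : M, Sum.inl (Sum.inl m) ∈ ω) ∨ ∃ s : S, Sum.inl (Sum.inr s) ∈ ω}

omit [Fintype M] [Fintype S] [Fintype T] in
/-- `conjMS` is increasing. [this work] -/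
theorem isUpperSet_conjMS : IsUpperSet (conjMS M S T) :=
  fun _ _ hab ⟨h1, h2⟩ => ⟨fun m => hab (h1 m), fun s => hab (h2 s)⟩

omit [Fintype M] [Fintype S] [Fintype T] in
/-- `disjMT` is increasing. [this work] -/
theorem isUpperSet_disjMT : IsUpperSet (disjMT M S T) := by
  rintro a b hab (⟨m, hm⟩ | ⟨t, ht⟩)
  · exact Or.inl ⟨m, hab hm⟩
  · exact Or.inr ⟨t, hab ht⟩

omit [Fintype M] [Fintype S] [Fintype T] in
/-- `disjMS` is increasing. [this work] -/
theorem isUpperSet_disjMS : IsUpperSet (disjMS M S T) := by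
  rintro a b hab (⟨m, hm⟩ | ⟨s, hs⟩)
  · exact Or.inl ⟨m, hab hm⟩
  · exact Or.inr ⟨s, hab hs⟩

omit [Fintype M] [Fintype S] [Fintype T] in
/-- The conjunction event pulled back through `split3`. [this work] -/
theorem ind_conjMS_eq : (liftX (liftX (ind (conjAll M)) * liftY (ind (conjAll S))) : (Set M × Set S) × Set T → ℝ) ∘ split3 M S T
    = ind (conjMS M S T) := by
  funext ω
  simp only [Function.comp_apply, split3_apply, liftX, Pi.mul_apply, liftY]
  by_cases h1 : Sum.inl ⁻¹' (Sum.inl ⁻¹' ω) ∈ conjAll M <;> by_cases h2 : Sum.inr ⁻¹' (Sum.inl ⁻¹' ω) ∈ conjAll S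
  · have h : ω ∈ conjMS M S T := ⟨fun m => h1 m, fun s => h2 s⟩
    rw [ind_of_mem h1, ind_of_mem h2, ind_of_mem h]; ring
  · have h : ω ∉ conjMS M S T := fun hh => h2 fun s => hh.2 s
    rw [ind_of_mem h1, ind_of_not_mem h2, ind_of_not_mem h]; ring
  · have h : ω ∉ conjMS M S T := fun hh => h1 fun m => hh.1 m
    rw [ind_of_not_mem h1, ind_of_not_mem h]; ring
  · have h : ω ∉ conjMS M S T := fun hh => h1 fun m => hh.1 m
    rw [ind_of_not_mem h1, ind_of_not_mem h]; ring

omit [Fintype M] [Fintype S] [Fintype T] in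
/-- The disjunction event (`M ⊔ T`) pulled back through `split3`. [this work] -/
theorem ind_disjMT_eq : (bor (liftX (ind (disjAll M))) (ind (disjAll T)) : (Set M × Set S) × Set T → ℝ) ∘ split3 M S T
    = ind (disjMT M S T) := by
  funext ω
  simp only [Function.comp_apply, split3_apply, bor, liftX]
  by_cases h1 : Sum.inl ⁻¹' (Sum.inl ⁻¹' ω) ∈ disjAll M <;> by_cases h2 : Sum.inr ⁻¹' ω ∈ disjAll T
  · have h : ω ∈ disjMT M S T := Or.inl (by obtain ⟨m, hm⟩ := h1; exact ⟨m, hm⟩)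
    rw [ind_of_mem h1, ind_of_mem h2, ind_of_mem h]; ring
  · have h : ω ∈ disjMT M S T := Or.inl (by obtain ⟨m, hm⟩ := h1; exact ⟨m, hm⟩)
    rw [ind_of_mem h1, ind_of_not_mem h2, ind_of_mem h]; ring
  · have h : ω ∈ disjMT M S T := Or.inr (by obtain ⟨t, ht⟩ := h2; exact ⟨t, ht⟩)
    rw [ind_of_not_mem h1, ind_of_mem h2, ind_of_mem h]; ring
  · have h : ω ∉ disjMT M S T := by
      rintro (⟨m, hm⟩ | ⟨t, ht⟩)
      · exact h1 ⟨m, hm⟩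
      · exact h2 ⟨t, ht⟩
    rw [ind_of_not_mem h1, ind_of_not_mem h2, ind_of_not_mem h]; ring

omit [Fintype M] [Fintype S] [Fintype T] in
/-- The disjunction event (`M ⊔ S`) pulled back through `split3`. [this work] -/
theorem ind_disjMS_eq : (liftX (bor (ind (disjAll M)) (ind (disjAll S))) : (Set M × Set S) × Set T → ℝ) ∘ split3 M S T
    = ind (disjMS M S T) := by
  funext ω
  simp only [Function.comp_apply, split3_apply, bor, liftX]
  by_cases h1 : Sum.inl ⁻¹' (Sum.inl ⁻¹' ω) ∈ disjAll M <;> by_cases h2 : Sum.inr ⁻¹' (Sum.inl ⁻¹' ω) ∈ disjAll S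
  · have h : ω ∈ disjMS M S T := Or.inl (by obtain ⟨m, hm⟩ := h1; exact ⟨m, hm⟩)
    rw [ind_of_mem h1, ind_of_mem h2, ind_of_mem h]; ring
  · have h : ω ∈ disjMS M S T := Or.inl (by obtain ⟨m, hm⟩ := h1; exact ⟨m, hm⟩)
    rw [ind_of_mem h1, ind_of_not_mem h2, ind_of_mem h]; ring
  · have h : ω ∈ disjMS M S T := Or.inr (by obtain ⟨s, hs⟩ := h2; exact ⟨s, hs⟩)
    rw [ind_of_not_mem h1, ind_of_mem h2, ind_of_mem h]; ring
  · have h : ω ∉ disjMS M S T := by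
      rintro (⟨m, hm⟩ | ⟨s, hs⟩)
      · exact h1 ⟨m, hm⟩
      · exact h2 ⟨s, hs⟩
    rw [ind_of_not_mem h1, ind_of_not_mem h2, ind_of_not_mem h]; ring

/-- **Kahn's inequality: conjunction versus disjunction of literals, arbitrary overlap.**  On `ι = (M ⊕ S) ⊕ T` with any product
measure, `B = ⋀_{M ⊔ S} x_i` (`conjMS`), `C = ⋁_{M ⊔ T} x_j` (`disjMT`): `0 ≤ sahiE3 (prodBernoulli p) A B C` for every increasing
event `A` [Kahn 2022, Conj. 5, for these triples]. [this work] -/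
theorem sahiE3_nonneg_conj_disj (p : (M ⊕ S) ⊕ T → unitInterval) {A : Set (Set ((M ⊕ S) ⊕ T))} (hA : IsUpperSet A) :
    0 ≤ sahiE3 (prodBernoulli p) A (conjMS M S T) (disjMT M S T) := by
  have hP := (peelable_conj_disj (p ∘ Sum.inl ∘ Sum.inl) (p ∘ Sum.inl ∘ Sum.inr) (p ∘ Sum.inr)).kahnPair
  have hK := kahnPair_comp_orderIso (split3 M S T) hP
  rw [← bernoulliWeight_eq_prodW3, ind_conjMS_eq, ind_disjMT_eq] at hK
  exact sahiE3_nonneg_of_kahnPair p hK hA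

/-- **Kahn's inequality: two disjunctions of literals with overlapping supports.**  On `ι = (M ⊕ S) ⊕ T` with any product
measure, `B = ⋁_{M ⊔ S} x_i` (`disjMS`), `C = ⋁_{M ⊔ T} x_j` (`disjMT`): `0 ≤ sahiE3 (prodBernoulli p) A B C` for every increasing
event `A`. [this work] -/
theorem sahiE3_nonneg_disj_disj (p : (M ⊕ S) ⊕ T → unitInterval) {A : Set (Set ((M ⊕ S) ⊕ T))} (hA : IsUpperSet A) :
    0 ≤ sahiE3 (prodBernoulli p) A (disjMS M S T) (disjMT M S T) := by
  have hP := (peelable_disj_disj (p ∘ Sum.inl ∘ Sum.inl) (p ∘ Sum.inl ∘ Sum.inr) (p ∘ Sum.inr)).kahnPair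
  have hK := kahnPair_comp_orderIso (split3 M S T) hP
  rw [← bernoulliWeight_eq_prodW3, ind_disjMS_eq, ind_disjMT_eq] at hK
  exact sahiE3_nonneg_of_kahnPair p hK hA

end Transport3

end Summit.CriticalPhenomena.PercolationContinuityZ3.Theorems.SahiKahnModule
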